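import Mathlib
import Literature.Barriers.PneNP.TSPExtensionComplexity
import Literature.Combinatorics.Optimization.BlockPsdLiftFactorization
import Literature.Combinatorics.Optimization.UdisjShiftNonnegativeRank
import HarnessLib

/-!
# Approximate extended formulations of the hard pair `(COR(n), Q(n))`:
# the Braun–Fiorini–Pokutta–Steurer sandwich bound

Layer `Literature/Barriers/PneNP` (next to `CorrelationPolytopeXCLowerBound.lean`, the exact bound
`xc(COR(n)) ≥ 1.5ⁿ`). Source read (pages in hand): G. Braun, S. Fiorini, S. Pokutta, D. Steurer,
*Approximation Limits of Linear Programs (Beyond Hierarchies)*, Math. Oper. Res. 40 (2015) 756–772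
(= FOCS 2012) [BraunEtAl2015]; theorem numbering and page files below are those of the held arXiv text
`paper:arxiv-1204.0957` (arXiv:1204.0957).

## Source, verbatim

§2.3 [p0006:L75–L81]: «Let `P` and `Q` be polyhedra with `P ⊆ Q ⊆ ℝ^d`. An extended formulation (EF) of
the pair `P,Q` is a system `Ex + Fy = g`, `y ≥ 0` defining a polyhedron
`K := {x ∈ ℝ^d ∣ Ex + Fy = g, y ≥ 0}` such that `P ⊆ K ⊆ Q`. We denote by `xc(P,Q)` the minimum size of
an EF of the pair `P,Q`.» (size = number of inequalities, i.e. of sign-constrained variables `y`).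

§4.1 «A Hard Pair» [p0013:L13–L39]: «The correlation polytope `COR(n)` is defined as the convex hull of all
the `n × n` rank-1 binary matrices of the form `bbᵀ` where `b ∈ {0,1}ⁿ`. […] This will be our inner polytope
`P`. Next, let `Q = Q(n) := {x ∈ ℝ^{n×n} ∣ ⟨2diag(a) − aaᵀ, x⟩ ≤ 1, a ∈ {0,1}ⁿ}`, where `⟨·,·⟩` denotes the
Frobenius inner product. This will be our outer polyhedron `Q`. Then the following is known, see [FMPTW].
First, `P ⊆ Q`. Second, denoting by `S^{P,Q}` the slack matrix of the pair `P,Q`, we have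
`S^{P,Q}_{ab} = (1 − aᵀb)²`. Thus, for `ρ ≥ 1`, we have `S^{P,ρQ}_{ab} = (1 − aᵀb)² + ρ − 1`.»

[p0013:L47–L55]: «**Theorem 6 (Lower bounds for approximate EFs of the hard pair).** Let `ρ ≥ 1`, let `n`
be a positive integer and let `P = COR(n)`, `Q = Q(n)` be as above. Then the following hold:
* If `ρ` is a fixed constant, then `xc(P, ρQ) = 2^{Ω(n)}`.
* If `ρ = O(n^β)` for some constant `β < 1/2`, then `xc(P, ρQ) = 2^{Ω(n^{1−2β})}`.»

The printed proof: `S^{P,ρQ}` is a `ρ`-extension of UDISJ, so Theorem 5 («Nonnegative rank of UDISJ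
shifts», [p0011:L195–p0012:L7]; from Razborov's rectangle corruption lemma; for `ρ ≤ C n^β` one takes
`ε = 1/(2C n^β)` and gets `r ≥ 2^{Ω(n^{1−2β})}`, [p0012:L53–L61]) bounds its nonnegative rank, and the
factorisation theorem for nested pairs (Theorem 1, [p0007:L1–L7]: `nnegrk(S^{P,Q}) − 1 ≤ xc(P,Q) ≤
nnegrk(S^{P,Q})`) transfers the bound to every EF of the pair.

## What is typed

* `corOuterRow a` — the row functional `x ↦ ⟨2 diag(𝟙_a) − 𝟙_a 𝟙_aᵀ, x⟩` of the outer description of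
  `Q(n)`, on the tree's flattened coordinates `ℝ^{n·n}` of `FixedSizePsdRank.corPolytope n = COR(n)`
  (`BlockPsdLiftFactorization.lean`; spelled with that file's `flat` and `bvec`, so that it is
  DEFINITIONALLY the functional `udRow a` used on the summit side); `corOuterDilate n ρ = {x ∣ ∀ a,
  corOuterRow a ⬝ x ≤ ρ}`, which for `ρ > 0` is literally the dilate `ρ • Q(n)`
  (`corOuterDilate_eq_smul`); the printed «First, `P ⊆ Q`» (`corPolytope_subset_corOuterDilate`).
* `BraunEtAl2015_corSandwichXC` — **Theorem 6, second bullet, AS PRINTED**, a named fact (`Prop`): for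
  every constant `β < 1/2` and every `ρ : ℕ → ℝ` with `ρ ≥ 1` and `ρ(n) = O(n^β)`, there are `c₀ > 0`
  and `n₀` such that for `n ≥ n₀` every `K` with `COR(n) ⊆ K ⊆ ρ(n)·Q(n)` admitting a size-`r` extended
  formulation (the tree's slack-form currency `HasEFOfSize K r` of `TSPExtensionComplexity.lean`, which
  is exactly the printed «system `Ex + Fy = g, y ≥ 0` defining `K`») has `2^{c₀ n^{1−2β}} ≤ r`; i.e.
  `xc(COR(n), ρQ(n)) ≥ 2^{Ω(n^{1−2β})}`. The `Ω`/`O` constants are existentially/universally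
  quantified in the only order the printed proof supports (they depend on `β` and on the function `ρ`).
* `corSandwichXC_quasipoly` — the COROLLARY in the rate currency of the requesting summit line
  (`Summits/ValiantsHypothesis/…/Cruxes/NNDivisionHard/Lines/virtual_passenger.lean ∷ CorSandwichHard`,
  ledger item wi-90390): instance `β = 1/4`, `ρ(n) = 1 + ⌊⌊√n⌋^{1/2}⌋ ≤ 2 n^{1/4}`, and
  `2^{(log₂ n + c)^c} < 2^{c₀ √n}` eventually — PROVED here from the named fact (real asymptotics via
  Mathlib's `isLittleO_log_rpow_rpow_atTop`). Its statement is, token for token after unfolding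
  `udRow`/`udMat`/`udInd` and the `abbrev T`, the summit-side `CorSandwichHard`.

STATUS: the named published result is DISCHARGED (`BraunEtAl2015_corSandwichXC_holds`, end of file): Razborov's
lemma with explicit corruption parameter (`Literature.Computability.Complexity.UdisjFrames.corruption_rankOne`),
Theorem 5 (`Literature.Combinatorics.Optimization.BFPS2012_udisjShiftRankHard_holds`) and the pair-factorisation
direction of Theorem 1 (`HasEFOfSize.exists_nonneg_factorization`) are all tree theorems now; consumers may still take
`(h : BraunEtAl2015_corSandwichXC)` and feed it `BraunEtAl2015_corSandwichXC_holds`; `corSandwichXC_quasipoly` likewise.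
Stronger printed ranges NOT typed: Braverman–Moitra (STOC 2013, `ρ = n^{1−ε}`), Braun–Pokutta (common
information). Nothing in this file bears on `P ≠ NP` / `VP ≠ VNP` beyond recording the printed bound.

## References

* G. Braun, S. Fiorini, S. Pokutta, D. Steurer, *Approximation limits of linear programs (beyond
  hierarchies)*, Math. Oper. Res. 40 (2015) 756–772; FOCS 2012; arXiv:1204.0957 — §2.3 (EF of a pair,
  `xc(P,Q)`), Thm. 1 (factorisation for nested pairs), §4.1 (the hard pair), Thm. 5, Thm. 6. Bib key
  `BraunEtAl2015`.
* S. Fiorini, S. Massar, S. Pokutta, H. R. Tiwary, R. de Wolf, *Exponential lower bounds for polytopes in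
  combinatorial optimization*, J. ACM 62 (2015) = arXiv:1111.0837, §4.1 eq. (4) and Lemma 6 (validity of
  `⟨2 diag(a) − aaᵀ, x⟩ ≤ 1` on `COR(n)`, slack `(1 − |a ∩ b|)²`). Bib key `FioriniEtAl2015`.
-/

noncomputable section

namespace Literature.Barriers.PneNP

open Matrix Finset Filter
open scoped Pointwise
open Literature.Combinatorics.Optimization.FixedSizePsdRank

/-! ### The outer polyhedron `Q(n)` and its dilates -/

/-- **BFPS's outer row functional** `x ↦ ⟨2 diag(a) − aaᵀ, x⟩` (`a ⊆ [n]`, Frobenius product, coordinates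
of `ℝ^{n×n}` flattened as for `FixedSizePsdRank.corPolytope`): the rows of the outer description
`Q(n) = {x ∣ ⟨2diag(a) − aaᵀ, x⟩ ≤ 1, a ∈ {0,1}ⁿ}`. Spelled with `FixedSizePsdRank.flat`/`bvec` exactly as
the summit-side `XcDivision.udRow a = flat (udMat a)` unfolds.
[cite: BraunEtAl2015, §4.1 «A Hard Pair» (arXiv:1204.0957 p. 13, p0013:L25–L31)]
[cite: FioriniEtAl2015, §4.1 eq. (4) (arXiv:1111.0837 p. 7)] -/
def corOuterRow {n : ℕ} (a : Finset (Fin n)) : Fin (n * n) → ℝ :=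
  flat fun i j => 2 * (if i = j then 1 else 0) * bvec (fun i => decide (i ∈ a)) i -
    bvec (fun i => decide (i ∈ a)) i * bvec (fun i => decide (i ∈ a)) j

/-- Unfolding lemma for `corOuterRow` (the printed row `⟨2 diag(a) − aaᵀ, ·⟩`, flattened).
[cite: BraunEtAl2015, §4.1 (arXiv:1204.0957 p. 13, p0013:L25–L31)] -/
theorem corOuterRow_def {n : ℕ} (a : Finset (Fin n)) :
    corOuterRow a = flat fun i j => 2 * (if i = j then 1 else 0) * bvec (fun i => decide (i ∈ a)) i -
      bvec (fun i => decide (i ∈ a)) i * bvec (fun i => decide (i ∈ a)) j := rfl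

/-- `⟨2 diag(u) − uuᵀ, x xᵀ⟩ = 2 Σ_i u_i x_i² − (Σ_i u_i x_i)²` for any weight vector `u` (FMPTW's
verification of their eq. (4) with `u = 𝟙_a`). [cite: FioriniEtAl2015, §4.1, eq. (4) (arXiv:1111.0837 p. 7)] -/
private theorem quad_two_diag_sub_outer' {n : ℕ} (u x : Fin n → ℝ) :
    ∑ i, ∑ j, (2 * (if i = j then 1 else 0) * u i - u i * u j) * (x i * x j) =
      2 * (∑ i, u i * (x i * x i)) - (∑ i, u i * x i) ^ 2 := by
  simp only [sub_mul, Finset.sum_sub_distrib]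
  congr 1
  · rw [Finset.mul_sum]
    refine Finset.sum_congr rfl fun i _ => ?_
    rw [Finset.sum_eq_single i]
    · simp; ring
    · intro j _ hji; simp [Ne.symm hji]
    · intro h; exact absurd (Finset.mem_univ i) h
  · rw [sq, Finset.sum_mul_sum]
    refine Finset.sum_congr rfl fun i _ => Finset.sum_congr rfl fun j _ => ?_
    ring

/-- On a rank-one point: `⟨2 diag(a) − aaᵀ, x xᵀ⟩ = 2 Σ_{i ∈ a} x_i² − (Σ_{i ∈ a} x_i)²` — on a `0/1` point
`bbᵀ` this is `2k − k²`, `k = |a ∩ b|`, whence the slack `1 − (2k − k²) = (1 − aᵀb)²`.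
[cite: BraunEtAl2015, §4.1 (p0013:L33–L36, «S^{P,Q}_{ab} = (1 − aᵀb)²»)]
[cite: FioriniEtAl2015, §4.1 eq. (4) and Lemma 6 (arXiv:1111.0837 pp. 7, 9)] -/
theorem corOuterRow_dotProduct_vecOuter {n : ℕ} (a : Finset (Fin n)) (x : Fin n → ℝ) :
    corOuterRow a ⬝ᵥ vecOuter n x = 2 * (∑ i ∈ a, x i * x i) - (∑ i ∈ a, x i) ^ 2 := by
  rw [corOuterRow_def, flat_dotProduct_vecOuter, quad_two_diag_sub_outer']
  have hind : ∀ i, bvec (fun i => decide (i ∈ a)) i = if i ∈ a then 1 else 0 := fun i => by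
    by_cases h : i ∈ a <;> simp [bvec, h]
  simp only [hind, ite_mul, one_mul, zero_mul, Finset.sum_ite_mem, Finset.univ_inter]

/-- **«First, `P ⊆ Q`»**: every row `⟨2 diag(a) − aaᵀ, ·⟩ ≤ 1` of `Q(n)` is valid on `COR(n)` (on a `0/1`
point the form is `2k − k² ≤ 1`; validity passes to the hull, `flat_dotProduct_le_of_mem_corPolytope`).
[cite: BraunEtAl2015, §4.1 (p0013:L33–L34)] [cite: FioriniEtAl2015, Lemma 6 (arXiv:1111.0837 p. 9)] -/
theorem corOuterRow_dotProduct_le_one_of_mem_corPolytope {n : ℕ} {x : Fin (n * n) → ℝ}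
    (hx : x ∈ corPolytope n) (a : Finset (Fin n)) : corOuterRow a ⬝ᵥ x ≤ 1 := by
  rw [corOuterRow_def]
  refine flat_dotProduct_le_of_mem_corPolytope hx ⟨(_, 1), fun y hy => ?_⟩
  change ∑ i, ∑ j, (2 * (if i = j then 1 else 0) * bvec (fun i => decide (i ∈ a)) i -
    bvec (fun i => decide (i ∈ a)) i * bvec (fun i => decide (i ∈ a)) j) * (y i * y j) ≤ 1
  rw [quad_two_diag_sub_outer']
  have hsq : ∀ i, y i * y i = y i := fun i => by rcases hy i with h | h <;> simp [h]
  simp only [hsq]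
  nlinarith [sq_nonneg (∑ i, bvec (fun i => decide (i ∈ a)) i * y i - 1)]

/-- **The dilated outer polyhedron `ρ·Q(n)`** through its outer description
`{x ∣ ⟨2 diag(a) − aaᵀ, x⟩ ≤ ρ for all a ⊆ [n]}` (`Q(n)` itself is `ρ = 1`; for `ρ > 0` this IS the
dilate `ρ • Q(n)`, `corOuterDilate_eq_smul`). [cite: BraunEtAl2015, §4.1 and Thm. 6 («ρQ», p0013:L36–L55)] -/
def corOuterDilate (n : ℕ) (ρ : ℝ) : Set (Fin (n * n) → ℝ) :=
  {x | ∀ a : Finset (Fin n), corOuterRow a ⬝ᵥ x ≤ ρ}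

/-- Membership in `ρ·Q(n)` through the outer description («`⟨2diag(a) − aaᵀ, x⟩ ≤ 1, a ∈ {0,1}ⁿ`», scaled by `ρ`).
[cite: BraunEtAl2015, §4.1 and Thm. 6 (arXiv:1204.0957 p. 13, p0013:L25–L55)] -/
theorem mem_corOuterDilate_iff {n : ℕ} {ρ : ℝ} {x : Fin (n * n) → ℝ} :
    x ∈ corOuterDilate n ρ ↔ ∀ a : Finset (Fin n), corOuterRow a ⬝ᵥ x ≤ ρ := Iff.rfl

/-- `{x ∣ ⟨2diag(a) − aaᵀ, x⟩ ≤ ρ ∀ a} = ρ • Q(n)` for `ρ > 0` (the outer description of a positive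
dilate). [cite: BraunEtAl2015, §4.1 («Thus, for ρ ≥ 1, we have S^{P,ρQ}_{ab} = (1 − aᵀb)² + ρ − 1», p0013:L36–L37)] -/
theorem corOuterDilate_eq_smul {n : ℕ} {ρ : ℝ} (hρ : 0 < ρ) :
    corOuterDilate n ρ = ρ • corOuterDilate n 1 := by
  ext x
  rw [Set.mem_smul_set]
  constructor
  · intro hx
    refine ⟨ρ⁻¹ • x, fun a => ?_, by rw [smul_inv_smul₀ hρ.ne']⟩
    rw [dotProduct_smul, smul_eq_mul]
    have := hx a
    rw [inv_mul_le_iff₀ hρ, mul_one]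
    exact this
  · rintro ⟨y, hy, rfl⟩ a
    rw [dotProduct_smul, smul_eq_mul]
    have := mul_le_mul_of_nonneg_left (hy a) hρ.le
    rwa [mul_one] at this

/-- **«First, `P ⊆ Q`»**, hence `COR(n) ⊆ ρ·Q(n)` for every `ρ ≥ 1`.
[cite: BraunEtAl2015, §4.1 (p0013:L33–L34) and Thm. 6 («Let ρ ≥ 1»)] -/
theorem corPolytope_subset_corOuterDilate {n : ℕ} {ρ : ℝ} (hρ : 1 ≤ ρ) :
    corPolytope n ⊆ corOuterDilate n ρ :=
  fun _ hx a => (corOuterRow_dotProduct_le_one_of_mem_corPolytope hx a).trans hρ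

/-! ### Theorem 6 (second bullet) as a named fact, and its quasi-polynomial corollary -/

/-- **Braun–Fiorini–Pokutta–Steurer, Thm. 6 (second bullet): lower bounds for approximate EFs of the
hard pair.** «Let `ρ ≥ 1`, let `n` be a positive integer and let `P = COR(n)`, `Q = Q(n)` be as above.
[…] If `ρ = O(n^β)` for some constant `β < 1/2`, then `xc(P, ρQ) = 2^{Ω(n^{1−2β})}`», where (§2.3) an EF
of the pair `P ⊆ Q` is «a system `Ex + Fy = g`, `y ≥ 0` defining a polyhedron `K := {x ∣ Ex + Fy = g,
y ≥ 0}` such that `P ⊆ K ⊆ Q`» and `xc(P,Q)` is «the minimum size of an EF of the pair» — in the tree's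
slack-form currency (`HasEFOfSize K r` = «`K` is the `x`-projection of some `Ex + Fy = g, y ∈ ℝ^r_{≥0}`»):
for every constant `β < 1/2` and every function `ρ ≥ 1` with `ρ(n) ≤ C n^β` (`n ≥ 1`), there are
`c₀ > 0` and `n₀` such that for all `n ≥ n₀`, every `K ⊆ ℝ^{n×n}` with `COR(n) ⊆ K ⊆ ρ(n)·Q(n)` and every
size-`r` EF of `K` satisfy `2^{c₀ · n^{1−2β}} ≤ r`. Statement only (the printed proof = Thm. 5, nonnegative
rank of UDISJ shifts via Razborov's lemma, + Thm. 1, factorisation for nested pairs; neither is in the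
tree). [cite: BraunEtAl2015, Thm. 6 with §2.3, §4.1, Thm. 5, Thm. 1 (arXiv:1204.0957 pp. 6–7, 11–13; p0013:L47–L55)] -/
def BraunEtAl2015_corSandwichXC : Prop :=
  ∀ β : ℝ, β < 1 / 2 → ∀ ρ : ℕ → ℝ, (∀ n, 1 ≤ ρ n) →
    (∃ C : ℝ, ∀ n : ℕ, 1 ≤ n → ρ n ≤ C * (n : ℝ) ^ β) →
    ∃ c₀ : ℝ, 0 < c₀ ∧ ∃ n₀ : ℕ, ∀ n ≥ n₀, ∀ (K : Set (Fin (n * n) → ℝ)) (r : ℕ),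
      corPolytope n ⊆ K → K ⊆ corOuterDilate n (ρ n) → HasEFOfSize K r →
      (2 : ℝ) ^ (c₀ * (n : ℝ) ^ (1 - 2 * β)) ≤ r

/-- `⌊⌊√n⌋^{1/2}⌋ ≤ n^{1/4}` (real fourth root). [cite: BraunEtAl2015, Thm. 6 (instance β = 1/4 of «ρ = O(n^β)»)] -/
private theorem natSqrt_natSqrt_le_rpow (n : ℕ) :
    (Nat.sqrt (Nat.sqrt n) : ℝ) ≤ (n : ℝ) ^ ((1 : ℝ) / 4) := by
  set s := Nat.sqrt (Nat.sqrt n) with hs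
  have h4 : s ^ 4 ≤ n := by
    have h1 : s * s ≤ Nat.sqrt n := Nat.sqrt_le (Nat.sqrt n)
    have h2 : Nat.sqrt n * Nat.sqrt n ≤ n := Nat.sqrt_le n
    calc s ^ 4 = (s * s) * (s * s) := by ring
      _ ≤ Nat.sqrt n * Nat.sqrt n := Nat.mul_le_mul h1 h1
      _ ≤ n := h2
  have h4' : ((s : ℝ) ^ 4) ≤ (n : ℝ) := by exact_mod_cast h4
  have hroot : ((s : ℝ) ^ 4) ^ ((1 : ℝ) / 4) = s := by
    rw [one_div, show (4 : ℝ) = ((4 : ℕ) : ℝ) by norm_num]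
    exact Real.pow_rpow_inv_natCast (Nat.cast_nonneg _) (by norm_num)
  calc (s : ℝ) = ((s : ℝ) ^ 4) ^ ((1 : ℝ) / 4) := hroot.symm
    _ ≤ (n : ℝ) ^ ((1 : ℝ) / 4) := Real.rpow_le_rpow (by positivity) h4' (by norm_num)

/-- Quasi-polynomials lose to `2^{c₀ √n}`: for `c₀ > 0` and `c ∈ ℕ`, eventually `(log₂ n + c)^c < c₀ · n^{1/2}`
(`Nat.log 2 n ≤ log n / log 2 ≤ 2 log n`, and `(log x)^c = o(x^{1/2})`, Mathlib `isLittleO_log_rpow_rpow_atTop`).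
[cite: BraunEtAl2015, Thm. 6 («2^{Ω(n^{1−2β})}» at β = 1/4 exceeds every quasi-polynomial)] -/
private theorem eventually_polylog_lt (c : ℕ) {c₀ : ℝ} (hc₀ : 0 < c₀) :
    ∃ n₁ : ℕ, ∀ n ≥ n₁, (((Nat.log 2 n + c) ^ c : ℕ) : ℝ) < c₀ * (n : ℝ) ^ ((1 : ℝ) / 2) := by
  -- `(log x)^c ≤ (c₀ / (2·3^c)) · x^{1/2}` for large real `x`
  have hε : (0 : ℝ) < c₀ / (2 * 3 ^ c) := by positivity
  have hlo := (isLittleO_log_rpow_rpow_atTop (c : ℝ) (by norm_num : (0 : ℝ) < 1 / 2)).bound hε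
  have hlog : ∀ᶠ x : ℝ in atTop, (c : ℝ) ≤ Real.log x := Real.tendsto_log_atTop.eventually_ge_atTop _
  have hreal : ∀ᶠ x : ℝ in atTop, ((Real.log x / Real.log 2 + c) ^ c : ℝ) < c₀ * x ^ ((1 : ℝ) / 2) := by
    filter_upwards [hlo, hlog, eventually_gt_atTop 1] with x hx hxc hx1
    have hlx : 0 < Real.log x := Real.log_pos hx1
    have hx0 : 0 < x := by linarith
    rw [Real.norm_of_nonneg (by positivity), Real.norm_of_nonneg (by positivity), Real.rpow_natCast] at hx
    have hl2 : Real.log x / Real.log 2 ≤ 2 * Real.log x := by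
      rw [div_le_iff₀ (Real.log_pos (by norm_num : (1 : ℝ) < 2))]
      have : (1 : ℝ) / 2 < Real.log 2 := by
        have := Real.log_two_gt_d9; linarith
      nlinarith
    have h3 : Real.log x / Real.log 2 + c ≤ 3 * Real.log x := by linarith
    have hpos : 0 < x ^ ((1 : ℝ) / 2) := Real.rpow_pos_of_pos hx0 _
    calc (Real.log x / Real.log 2 + c) ^ c ≤ (3 * Real.log x) ^ c := by
            gcongr
      _ = 3 ^ c * Real.log x ^ c := by rw [mul_pow]
      _ ≤ 3 ^ c * (c₀ / (2 * 3 ^ c) * x ^ ((1 : ℝ) / 2)) := by gcongr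
      _ = c₀ / 2 * x ^ ((1 : ℝ) / 2) := by field_simp
      _ < c₀ * x ^ ((1 : ℝ) / 2) := by nlinarith
  -- pass to natural `n`, using `Nat.log 2 n ≤ log n / log 2`
  obtain ⟨N, hN⟩ := Filter.eventually_atTop.1
    ((tendsto_natCast_atTop_atTop.eventually hreal).and (eventually_ge_atTop 1))
  refine ⟨N, fun n hn => ?_⟩
  obtain ⟨hn1, hn2⟩ := hN n hn
  have hn0 : (0 : ℝ) < n := by exact_mod_cast hn2
  have hlogle : (Nat.log 2 n : ℝ) ≤ Real.log n / Real.log 2 := by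
    rw [le_div_iff₀ (Real.log_pos (by norm_num : (1 : ℝ) < 2)), ← Real.log_pow]
    refine Real.log_le_log (by positivity) ?_
    exact_mod_cast Nat.pow_log_le_self 2 (by omega : n ≠ 0)
  calc (((Nat.log 2 n + c) ^ c : ℕ) : ℝ) = ((Nat.log 2 n : ℝ) + c) ^ c := by push_cast; ring
    _ ≤ (Real.log n / Real.log 2 + c) ^ c := by
          gcongr
    _ < c₀ * (n : ℝ) ^ ((1 : ℝ) / 2) := hn1

/-- **Corollary (the sandwich bound at `ρ = 1 + ⌊n^{1/4}⌋`, quasi-polynomial rate)** — the instance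
`β = 1/4` of Theorem 6 in the rate currency of the summit line `virtual_passenger` (its `CorSandwichHard`,
token for token once `XcDivision.udRow`/`udMat`/`udInd` and the `abbrev T c n = 2^{(log₂ n + c)^c}` are
unfolded): every `K` with `COR(n) ⊆ K ⊆ {x ∣ ⟨2diag(a) − aaᵀ, x⟩ ≤ 1 + ⌊⌊√n⌋^{1/2}⌋ ∀ a}` admitting a
size-`r` EF has `2^{(log₂ n + c)^c} < r` for `n ≥ n₀(c)`. PROVED from the named fact: `ρ(n) =
1 + ⌊⌊√n⌋^{1/2}⌋ ≤ 2 n^{1/4}` (`β = 1/4 < 1/2`), and `2^{(log₂ n + c)^c} < 2^{c₀ n^{1/2}}` eventually.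
[cite: BraunEtAl2015, Thm. 6, second bullet, instance β = 1/4 (arXiv:1204.0957 p. 13, p0013:L54–L55)] -/
theorem corSandwichXC_quasipoly (h : BraunEtAl2015_corSandwichXC) :
    ∀ c : ℕ, ∃ n₀ : ℕ, ∀ n ≥ n₀, ∀ (K : Set (Fin (n * n) → ℝ)) (r : ℕ),
      corPolytope n ⊆ K →
      (∀ x ∈ K, ∀ a : Finset (Fin n), corOuterRow a ⬝ᵥ x ≤ 1 + Nat.sqrt (Nat.sqrt n)) →
      HasEFOfSize K r → 2 ^ ((Nat.log 2 n + c) ^ c) < r := by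
  intro c
  -- the function `ρ(n) = 1 + ⌊⌊√n⌋^{1/2}⌋` is `≥ 1` and `≤ 2 n^{1/4}`
  set ρ : ℕ → ℝ := fun n => 1 + (Nat.sqrt (Nat.sqrt n) : ℝ) with hρ
  have hρ1 : ∀ n, 1 ≤ ρ n := fun n => le_add_of_nonneg_right (Nat.cast_nonneg _)
  have hρC : ∃ C : ℝ, ∀ n : ℕ, 1 ≤ n → ρ n ≤ C * (n : ℝ) ^ ((1 : ℝ) / 4) := by
    refine ⟨2, fun n hn => ?_⟩
    have h1 : (1 : ℝ) ≤ (n : ℝ) ^ ((1 : ℝ) / 4) := Real.one_le_rpow (by exact_mod_cast hn) (by norm_num)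
    have h2 := natSqrt_natSqrt_le_rpow n
    change 1 + (Nat.sqrt (Nat.sqrt n) : ℝ) ≤ _
    linarith
  obtain ⟨c₀, hc₀, n₀, hn₀⟩ := h (1 / 4) (by norm_num) ρ hρ1 hρC
  obtain ⟨n₁, hn₁⟩ := eventually_polylog_lt c hc₀
  refine ⟨max n₀ n₁, fun n hn K r hP hQ hK => ?_⟩
  have hle : (2 : ℝ) ^ (c₀ * (n : ℝ) ^ (1 - 2 * ((1 : ℝ) / 4))) ≤ r :=
    hn₀ n (le_trans (le_max_left _ _) hn) K r hP (fun x hx a => hQ x hx a) hK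
  have hexp : (((Nat.log 2 n + c) ^ c : ℕ) : ℝ) < c₀ * (n : ℝ) ^ (1 - 2 * ((1 : ℝ) / 4)) := by
    rw [show (1 : ℝ) - 2 * (1 / 4) = 1 / 2 by norm_num]
    exact hn₁ n (le_trans (le_max_right _ _) hn)
  have hlt : ((2 ^ ((Nat.log 2 n + c) ^ c) : ℕ) : ℝ) < r := by
    calc ((2 ^ ((Nat.log 2 n + c) ^ c) : ℕ) : ℝ) = (2 : ℝ) ^ ((((Nat.log 2 n + c) ^ c : ℕ) : ℝ)) := by
          rw [Real.rpow_natCast]; push_cast; ring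
      _ < (2 : ℝ) ^ (c₀ * (n : ℝ) ^ (1 - 2 * ((1 : ℝ) / 4))) :=
          Real.rpow_lt_rpow_of_exponent_lt (by norm_num) hexp
      _ ≤ r := hle
  exact_mod_cast hlt


/-! ### The discharge: Theorem 6 (second bullet) from the tree's Theorem 5 -/

/-- The two spellings of BFPS's outer rows agree: `⟨2 diag(𝟙_A) − 𝟙_A 𝟙_Aᵀ, ·⟩` (this file, `A ⊆ [n]`) is
`⟨2·diag(a) − aaᵀ, ·⟩` of `CorPolytopeApproximateEFLowerBound.corCliqueMat` at the indicator string `a` of `A`.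
[cite: BraunEtAl2015, §4.1 (arXiv:1204.0957 p. 13, p0013:L25–L31)] -/
theorem corOuterRow_eq_flat_corCliqueMat {n : ℕ} (A : Finset (Fin n)) :
    corOuterRow A = flat (Literature.Combinatorics.Optimization.corCliqueMat (fun i => decide (i ∈ A))) := by
  rw [corOuterRow_def]
  unfold Literature.Combinatorics.Optimization.corCliqueMat
  congr 1
  funext i j
  simp only [Matrix.sub_apply, Matrix.smul_apply, Matrix.diagonal_apply, Matrix.vecMulVec_apply, smul_eq_mul]
  split_ifs with h
  · subst h; ring
  · ring

/-- `ρ·Q(n)` in the `Finset`-row spelling is contained in (indeed equal to) the `Cube`-row spelling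
`corOuter n ρ` of `CorPolytopeApproximateEFLowerBound.lean`. [cite: BraunEtAl2015, §4.1 and Thm. 6 («ρQ»,
p0013:L36–L55)] -/
theorem corOuterDilate_subset_corOuter {n : ℕ} (ρ : ℝ) :
    corOuterDilate n ρ ⊆ Literature.Combinatorics.Optimization.corOuter n ρ := by
  intro x hx a
  have hA : (fun i => decide (i ∈ (Finset.univ.filter fun i => a i = true))) = a := by
    funext i; simp
  have := hx (Finset.univ.filter fun i => a i = true)
  rwa [corOuterRow_eq_flat_corCliqueMat, hA] at this

/-- For `β < 0` the hypothesis «`1 ≤ ρ(n) ≤ C n^β` for all `n ≥ 1`» fails for large `n`.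
[cite: BraunEtAl2015, Thm. 6 («ρ ≥ 1», «ρ = O(n^β)», p0013:L47–L55)] -/
private theorem eventually_mul_rpow_lt_one {β : ℝ} (hβ : β < 0) (C : ℝ) :
    ∃ n₀ : ℕ, ∀ n : ℕ, n₀ ≤ n → C * (n : ℝ) ^ β < 1 := by
  rcases le_or_gt C 0 with hC | hC
  · exact ⟨1, fun n hn => (mul_nonpos_of_nonpos_of_nonneg hC (by positivity)).trans_lt one_pos⟩
  · refine ⟨⌈C ^ (1 / (-β))⌉₊ + 1, fun n hn => ?_⟩
    have hn0 : (0 : ℝ) < n := by exact_mod_cast (by omega : 0 < n)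
    have h1 : C ^ (1 / (-β)) < n := lt_of_le_of_lt (Nat.le_ceil _) (by exact_mod_cast (by omega : ⌈C ^ (1 / (-β))⌉₊ < n))
    have h2 : (C ^ (1 / (-β))) ^ (-β) < (n : ℝ) ^ (-β) := Real.rpow_lt_rpow (by positivity) h1 (by linarith)
    rw [← Real.rpow_mul hC.le, show 1 / (-β) * (-β) = 1 by rw [one_div, inv_mul_cancel₀ (neg_ne_zero.2 hβ.ne)],
      Real.rpow_one, Real.rpow_neg hn0.le] at h2
    have hpos : (0 : ℝ) < (n : ℝ) ^ β := Real.rpow_pos_of_pos hn0 _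
    rw [lt_inv_comm₀ hC hpos] at h2
    calc C * (n : ℝ) ^ β < C * C⁻¹ := mul_lt_mul_of_pos_left h2 hC
      _ = 1 := mul_inv_cancel₀ hC.ne'

/-- ★ **Braun–Fiorini–Pokutta–Steurer, Thm. 6 (second bullet) — DISCHARGED.**  For `0 ≤ β < 1/2`: from the
tree's `BFPS2012_corSandwichHard_holds` (the `Cube`-row spelling, constant `max C 1 > 0`) through
`corOuterDilate_subset_corOuter`; for `β < 0` the hypotheses «`ρ ≥ 1`, `ρ(n) ≤ C n^β` (`n ≥ 1`)» are
contradictory for `n ≥ n₀(β, C)`, so the conclusion holds vacuously there.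
[cite: BraunEtAl2015, Thm. 6 (arXiv:1204.0957 p. 13, p0013:L47–L55); Thm. 5 (pp. 11–12); Thm. 1 (p. 7)] -/
theorem BraunEtAl2015_corSandwichXC_holds : BraunEtAl2015_corSandwichXC := by
  intro β hβ ρ hρ1 hρC
  obtain ⟨C, hC⟩ := hρC
  rcases lt_or_ge β 0 with hβ0 | hβ0
  · -- vacuous range
    obtain ⟨n₀, hn₀⟩ := eventually_mul_rpow_lt_one hβ0 C
    refine ⟨1, one_pos, max n₀ 1, fun n hn K r _ _ _ => ?_⟩
    exfalso
    have h1 := hρ1 n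
    have h2 := hC n (le_trans (le_max_right _ _) hn)
    have h3 := hn₀ n (le_trans (le_max_left _ _) hn)
    linarith
  · set C' := max C 1 with hC'
    have hC'0 : 0 < C' := lt_of_lt_of_le one_pos (le_max_right _ _)
    obtain ⟨c, hc, n₀, hn₀⟩ :=
      Literature.Combinatorics.Optimization.BFPS2012_corSandwichHard_holds β hβ0 hβ C' hC'0
    refine ⟨c, hc, max n₀ 1, fun n hn K r hP hQ hEF => ?_⟩
    have hn1 : 1 ≤ n := le_trans (le_max_right _ _) hn
    have hρn : ρ n ≤ C' * (n : ℝ) ^ β :=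
      (hC n hn1).trans (mul_le_mul_of_nonneg_right (le_max_left _ _) (by positivity))
    exact hn₀ n (le_trans (le_max_left _ _) hn) (ρ n) (hρ1 n) hρn K r hP
      (hQ.trans (corOuterDilate_subset_corOuter (ρ n))) hEF

end Literature.Barriers.PneNP

end
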